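import Literature.MathematicalPhysics.QuantumFieldTheory.Balaban1983to89.B6Eq2112Assembly
import Literature.MathematicalPhysics.QuantumFieldTheory.Balaban1983to89.B6CovarianceOperator

/-!
# `Balaban1983to89.B6SectCOperators` — T. Bałaban, *Propagators and renormalization transformations for lattice gauge
# theories. II*, Commun. Math. Phys. **96** (1984) 223–250 [Balaban1984PropagatorsII], Sect. C pp. 239–246: the OPERATORS
# of the representation (2.129) — `R`, `P` (2.10)/(2.17), `Δ_a`, `G = Δ_a⁻¹` (2.19)/(2.22), `Δ′_j`, `C^{(j)}_Λ` (2.106)–(2.110),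
# `G_j`, `(Q_jG_jQ_j*)⁻¹` ([4] (1.69)–(1.71)), `H_j` (2.130), `G̃_j` (2.131), `Δ_j` (2.118), `C̃^{(j)}_Λ` (p. 246) — DEFINED from
# the primitive two-scale lattice data, with their printed defining properties PROVED from the two printed positivity facts

statement-level skeleton of published theorems with citation tags; proofs where landed; nothing here is a claim about the Yang–Mills mass gap

PDF held: `paper:balaban1984-cmp96-propagators-rt-ii` (journal page = PDF page + 222); pp. 224–228, 239–246 read AS IMAGES on
the ×2 renders `run/shared/lean/pub/pub-balaban/b2b-balaban-ref1/pages/1984-cmp96-propagators-rt-II/` (2026-08-21).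
CITATION HEADER (lean-in-tree rule).  WHAT IS REPRODUCED: lit-balaban SKELETON rows **B6.Eq2.129 / B6.Eq2.119** (with
B6.Eq2.130, B6.Eq2.131, B6.Eq2.110): in the files of this seat that PROVE (2.119)/(2.129) (`…B6GaussianIdentity2119`,
`…B6Repr2129`, `…B6Eq2112Assembly`, `…B6Eq2112Lebesgue`) every derived operator of Sect. C (the projections `R`, `P`, `R_j`,
`P_j`, the propagator `G`, the covariances `C^{(j)}_Λ`, `G̃_j`, `C̃^{(j)}_Λ`, the translation operator `H_j`, `Δ_j`) is a DATUM
carried with its defining property as a hypothesis.  Here they are DEFINITIONS over the primitive data of the two-scale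
construction (bundled as `TwoScaleData`: `Δ, ∂, ∂*, curl` on the fine lattice, `Δ` on scalars, `Q′_j`, the admissible `ω`,
`H′_j` (2.101), `Q_j`, `∂₁`, the axial `B`, `Q″`, `a`) and their printed properties are THEOREMS under the printed lattice
identities (`IsLattice`) and the two printed positivity facts (`Positive`): p. 226 *"the operator Δ_a is bounded from below by
a positive constant"* (in the qualitative form of Sect. A: the three squares of (2.19) vanish only at `A = 0`) and (2.11)
*"the Laplace operator Δ is … invertible on this subspace"* `N(Q′)`.  The companion `…B6Repr2129Positivity` (same seat) then
proves (2.119)/(2.129) for THESE operators with no analytic hypothesis beyond `Positive`.  PHASE-2 seat p22 (gen 8); owner r03,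
referee ref-4.  IMPORTS, restating nothing: `…B6Eq2112Assembly` (gen 7; through it `…B6Eq2130` = the printed `H_j`/`G̃_j` via
`…B6SectA.hOp`/`tildeOp`, `…B6Eq297GaugeFixing`, `Mj_symm`/`deltaA_symm`), `…B6CovarianceOperator` (same seat: `Ring.inverse`
facts, `covOp`).

PRINT (verbatim).  p. 226: *"Δ_a = ∂*∂ + ∂R∂* + Q*aQ = Δ − ∂P∂* + Q*aQ, (2.19) … One of our main results will be that the operator
Δ_a is bounded from below by a positive constant, hence the first equation implies A = G∂Rλ + GQ*ω, G = Δ_a⁻¹. (2.22)"*; p. 225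
(2.10)–(2.11): *"let R be an orthogonal projection in the space L²(T_η) onto the subspace ΔN(Q′) … the Laplace operator Δ is positive
on the subspace N(Q′), hence it is invertible on this subspace"*; p. 241, after (2.101)–(2.103): *"Let us denote the operator in (2.101)
by H′_j, so λ = H′_jμ"*, *"where the equality Q′_jλ = Q′_jH′_jμ = μ was used"* (in operator form: `Q′_jH′_j = I` on the `μ`'s —
our reading); p. 242: *"γ₀‖ω‖² ≦ ⟨ω, Δ′_jω⟩ ≦ γ₁‖ω‖² for ω : Q′₁ω = 0, (2.110) with positive constants γ₀, γ₁ dependent on d and L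
only. From the theorem on unit lattice operators in [3] it follows that a covariance C^{(j)}_Λ of the last Gaussian integrals in (2.106)
is a bounded operator with an exponential decay independent of j and Λ"*; p. 243: *"Let us denote a covariance of this Gaussian integral
by G̃_j"*; p. 246: *"These forms are bounded from below by γ₀″‖B‖² with a positive constant γ₀″ dependent on d and L only. This implies
that a covariance C̃^{(j)}_Λ of the Gaussian integral in (2.119) is bounded from above by a positive constant dependent on d and L only
… H_j = G_jQ_j*(Q_jG_jQ_j*)⁻¹ (2.130) … G̃_j = G_j − G_jQ_j*(Q_jG_jQ_j*)⁻¹Q_jG_j. (2.131)"*.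

CONTENTS (definition lane: 3 structures (`TwoScaleData`; the Prop-structures `IsLattice`, `Positive`), 26 defs/abbrevs with
bodies, theorems; 0 sorry; standard axioms).  §2 `TwoScaleData` and the DERIVED OPERATORS: `NQ = N(Q′)`, `Nj = N(Q′_j)`, the
gauge-fixed configurations `Sg`, `NA = {Q_jA = 0}`; `R`, `P`, `R_j`, `P_j`; `Q = Q″Q_j`; `deltaA = Δ_a` (`…B6SectA.deltaA`), `G =
Ring.inverse Δ_a`; `Mj = Δ − ∂P_j∂*`; `Dp = Δ′_j = H′_j*Δ²H′_j`, `C = covOp S₁ Δ′_j` (+ factor `TC`); `Gj = (M_j + Q_j*Q_j)⁻¹`, `Ej =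
(Q_jG_jQ_j*)⁻¹`, **`Hj = …B6SectA.hOp Gj Q_j* Ej` (2.130)**, `Gt = covOp {Q_jA = 0} M_j` (+ `Tt`; = the printed (2.131), proved in
`…B6SectCPositivity`), `Δj = H_j*M_jH_j`, `Sb = Q″*aQ″ + Δ_j`, `Ct = covOp Ax Sb` (+ `TB`), `K1 = ∂H′_jCH′_j*∂*`, `K2 = ∂ΔH′_jCH′_j*∂*`,
the (2.112)/(2.120) form `form2112`; the printed identities `IsLattice`; the two positivity facts `Positive`.  §3 (first part;
the rest is `…B6SectCPositivity`): unfoldings (`R_apply`, …, `range_lap_NQ/Nj` = the `hK`/`hKj` of `…B6Eq2112`), adjoint pairings,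
symmetry of `Δ` (both), `M_j`, `Δ_a`, the forms **`⟨A,M_jA⟩ = ‖curl A‖² + ‖R_j∂*A‖²`**, **`⟨A,Δ_aA⟩ = ‖curl A‖² + ‖R∂*A‖² + ⟨QA,aQA⟩`**,
`R∂*A = 0 ⟺ ∂*A ⊥ ΔN(Q′)`.
HONEST SCOPE: finite-dimensional inner-product-space model; `G_j` is taken with `a = 1` in `Δ − ∂P_j∂* + Q_j*aQ_j` (`H_j`, `G̃_j` do
not depend on this choice: `…B6Eq2130.hOp_unique`, `cov_unique`); the two positivity facts and the lattice identities are
hypotheses (their own rows: B6.Eq2.11, B6.Eq2.19/2.22/2.35 (p21 V1 files), (2.96), (2.98), (2.103)–(2.104)); NOT summit progress.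
Unit `lit-balaban-p22` (gen 8), HOME `run/shared/lean/pub/lit-balaban/`, 2026-08-21.
-/

noncomputable section

open scoped InnerProductSpace

namespace Literature.MathematicalPhysics.QuantumFieldTheory.Balaban1983to89.B6SectCOperators

open B6CovarianceOperator

/-! ## §2  The primitive two-scale data of Sect. C and the derived operators -/

/-- **The primitive data of the two-scale construction of Sect. C** (pp. 239–241) over finite-dimensional `ℓ²` spaces: `A` =
vector fields on the fine bonds, `B` = scalar fields on the fine sites, `W` = scalar fields on the unit lattice of order `j`,
`T` = plaquette fields, `Bs` = vector fields on the unit lattice, `V` = the range of `Q″` (the two-scale averaging data on `𝔅 =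
Λ^c ∪ Λ′`).  Fields: `lapV = Δ` and `curl`, `grad = ∂`, `dv = ∂*` on vector fields; `lap = Δ` on scalars; `Qp = Q′_j`; `S₁` = the
admissible `ω` (*"configurations ω … defined on Λ"* with `Q′₁ω = 0` on `Λ′`); `hP = H′_j` (2.101); `Qv = Q_j`; `d1 = ∂₁` (the
unit-lattice gradient); `Ax` = the axial `B` (`Π_{y∈Λ′}δ_{Ax(y)}(B)`); `Qpp = Q″` ((2.119): `Q = Q″Q_j`); `a` = the weight of
`⟨QA,aQA⟩`. [cite: Balaban1984PropagatorsII, (2.95)–(2.104) pp.240–241] -/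
structure TwoScaleData (A B W T Bs V : Type*)
    [NormedAddCommGroup A] [InnerProductSpace ℝ A] [FiniteDimensional ℝ A]
    [NormedAddCommGroup B] [InnerProductSpace ℝ B] [FiniteDimensional ℝ B]
    [NormedAddCommGroup W] [InnerProductSpace ℝ W] [FiniteDimensional ℝ W]
    [NormedAddCommGroup T] [InnerProductSpace ℝ T] [FiniteDimensional ℝ T]
    [NormedAddCommGroup Bs] [InnerProductSpace ℝ Bs] [FiniteDimensional ℝ Bs]
    [NormedAddCommGroup V] [InnerProductSpace ℝ V] [FiniteDimensional ℝ V] where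
  /-- `Δ` on vector fields -/
  lapV : A →ₗ[ℝ] A
  /-- the plaquette curl `∂` of a vector field -/
  curl : A →ₗ[ℝ] T
  /-- the gradient `∂` of a scalar field -/
  grad : B →ₗ[ℝ] A
  /-- the divergence `∂*` -/
  dv : A →ₗ[ℝ] B
  /-- `Δ` on scalar fields -/
  lap : B →ₗ[ℝ] B
  /-- `Q′_j` -/
  Qp : B →ₗ[ℝ] W
  /-- the admissible `ω` -/
  S₁ : Submodule ℝ W
  /-- `H′_j` of (2.101) -/
  hP : W →ₗ[ℝ] B
  /-- `Q_j` -/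
  Qv : A →ₗ[ℝ] Bs
  /-- `∂₁`, the gradient of the unit lattice -/
  d1 : W →ₗ[ℝ] Bs
  /-- the axial-gauge `B` -/
  Ax : Submodule ℝ Bs
  /-- `Q″` -/
  Qpp : Bs →ₗ[ℝ] V
  /-- the weight `a` -/
  a : V →ₗ[ℝ] V

namespace TwoScaleData

variable {A B W T Bs V : Type*}
  [NormedAddCommGroup A] [InnerProductSpace ℝ A] [FiniteDimensional ℝ A]
  [NormedAddCommGroup B] [InnerProductSpace ℝ B] [FiniteDimensional ℝ B]
  [NormedAddCommGroup W] [InnerProductSpace ℝ W] [FiniteDimensional ℝ W]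
  [NormedAddCommGroup T] [InnerProductSpace ℝ T] [FiniteDimensional ℝ T]
  [NormedAddCommGroup Bs] [InnerProductSpace ℝ Bs] [FiniteDimensional ℝ Bs]
  [NormedAddCommGroup V] [InnerProductSpace ℝ V] [FiniteDimensional ℝ V]
  (D : TwoScaleData A B W T Bs V)

/-- `N(Q′) = {λ : Q′_jλ = Q′_jH′_jω admissible}` — the gauge functions of the two-scale construction (*"λ₀ … belongs to N(Q′)"*,
(2.105); `…B6Eq2106` §1). [cite: Balaban1984PropagatorsII, (2.7) p.224 + (2.105) p.241] -/
abbrev NQ : Submodule ℝ B := Submodule.comap D.Qp D.S₁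

/-- `N(Q′_j) = ker Q′_j`. [cite: Balaban1984PropagatorsII, (2.95) p.240] -/
abbrev Nj : Submodule ℝ B := LinearMap.ker D.Qp

/-- The gauge-fixed configurations `{A : Π_{y∈Λ′}δ_{Ax(y)}(Q_jA) ≠ 0}` = `{A : Q_jA axial}` of (2.97)/(2.112).
[cite: Balaban1984PropagatorsII, (2.97) p.240 + (2.112) p.243] -/
abbrev Sg : Submodule ℝ A := Submodule.comap D.Qv D.Ax

/-- `{A : Q_jA = 0}`, the carrier of the Gaussian (2.114). [cite: Balaban1984PropagatorsII, (2.114) p.243] -/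
abbrev NA : Submodule ℝ A := LinearMap.ker D.Qv

/-- `R` = the orthogonal projection onto `ΔN(Q′)` (2.10), as a linear map. [cite: Balaban1984PropagatorsII, (2.10) p.225] -/
def R : B →ₗ[ℝ] B := ((D.NQ.map D.lap).starProjection : B →L[ℝ] B)

/-- `P = I − R` (2.17). [cite: Balaban1984PropagatorsII, (2.17) p.226] -/
def P : B →ₗ[ℝ] B := LinearMap.id - D.R

/-- `R_j` = the orthogonal projection onto `ΔN(Q′_j)` ((2.97): *"I − P_j = R_j"*). [cite: Balaban1984PropagatorsII, (2.97) p.240] -/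
def Rj : B →ₗ[ℝ] B := ((D.Nj.map D.lap).starProjection : B →L[ℝ] B)

/-- `P_j = I − R_j`. [cite: Balaban1984PropagatorsII, (2.97) p.240] -/
def Pj : B →ₗ[ℝ] B := LinearMap.id - D.Rj

/-- `Q = Q″Q_j` — the two-scale averaging of (2.95), factored as in (2.119). [cite: Balaban1984PropagatorsII, (2.20) p.226 + (2.119) p.243] -/
def Q : A →ₗ[ℝ] V := D.Qpp ∘ₗ D.Qv

/-- `Δ_a = Δ − ∂P∂* + Q*aQ` (2.19) (`…B6SectA.deltaA` with `Q*` the adjoint of `Q`). [cite: Balaban1984PropagatorsII, (2.19) p.226] -/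
def deltaA : A →ₗ[ℝ] A := B6SectA.deltaA D.lapV D.grad D.dv D.P D.Q (LinearMap.adjoint D.Q) D.a

/-- `G = Δ_a⁻¹` (2.22). [cite: Balaban1984PropagatorsII, (2.22) p.226] -/
def G : A →ₗ[ℝ] A := Ring.inverse D.deltaA

/-- `M_j = Δ − ∂P_j∂*`, the operator of the Gaussians (2.112)–(2.116). [cite: Balaban1984PropagatorsII, (2.112) p.243] -/
def Mj : A →ₗ[ℝ] A := D.lapV - D.grad ∘ₗ D.Pj ∘ₗ D.dv

/-- `Δ′_j = H′_j*Δ²H′_j` restricted as a form to the admissible `ω` ((2.107): *"⟨ω,Δ′_jω′⟩ = ⟨ΔH′_jω, ΔH′_jω′⟩"*).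
[cite: Balaban1984PropagatorsII, (2.107) p.242] -/
def Dp : W →ₗ[ℝ] W := LinearMap.adjoint D.hP ∘ₗ D.lap ∘ₗ D.lap ∘ₗ D.hP

/-- `C^{(j)}_Λ` — *"a covariance of the last Gaussian integrals"* of (2.106), i.e. of `Δ′_j` on the admissible `ω`.
[cite: Balaban1984PropagatorsII, (2.106)–(2.110) p.242] -/
def C : W →ₗ[ℝ] W := covOp D.S₁ D.Dp

/-- The `S₁`-valued factor of `C^{(j)}_Λ`. [cite: Balaban1984PropagatorsII, (2.110) p.242] -/
def TC : W →ₗ[ℝ] ↥D.S₁ := covOpT D.S₁ D.Dp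

/-- `G_j = (Δ − ∂P_j∂* + Q_j*Q_j)⁻¹` — the propagator of [4] (1.69)–(1.71) *"defined by averaging operations … uniformly of
order j"* (weight `a = 1`; `H_j`, `G̃_j` below do not depend on it). [cite: Balaban1984PropagatorsII, (2.130) p.246] -/
def Gj : A →ₗ[ℝ] A := Ring.inverse (D.Mj + LinearMap.adjoint D.Qv ∘ₗ D.Qv)

/-- `(Q_jG_jQ_j*)⁻¹`. [cite: Balaban1984PropagatorsII, (2.130) p.246] -/
def Ej : Bs →ₗ[ℝ] Bs := Ring.inverse (D.Qv ∘ₗ D.Gj ∘ₗ LinearMap.adjoint D.Qv)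

/-- **`H_j = G_jQ_j*(Q_jG_jQ_j*)⁻¹` (2.130)** (`…B6SectA.hOp`). [cite: Balaban1984PropagatorsII, (2.130) p.246] -/
def Hj : Bs →ₗ[ℝ] A := B6SectA.hOp D.Gj (LinearMap.adjoint D.Qv) D.Ej

/-- `G̃_j` — *"a covariance of this Gaussian integral"* (2.114)–(2.115): the covariance of `M_j` on `{Q_jA = 0}`; equal to the
printed (2.131) (`Gt_eq_tildeOp`). [cite: Balaban1984PropagatorsII, (2.115) p.243 + (2.131) p.246] -/
def Gt : A →ₗ[ℝ] A := covOp D.NA D.Mj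

/-- The `{Q_jA = 0}`-valued factor of `G̃_j`. [cite: Balaban1984PropagatorsII, (2.115) p.243] -/
def Tt : A →ₗ[ℝ] ↥D.NA := covOpT D.NA D.Mj

/-- `Δ_j = H_j*(Δ − ∂P_j∂*)H_j` — the quadratic form of (2.116)–(2.118) (*"the quadratic forms are equal to ⟨B, Δ_jB⟩"*).
[cite: Balaban1984PropagatorsII, (2.116)–(2.118) p.243] -/
def Δj : Bs →ₗ[ℝ] Bs := LinearMap.adjoint D.Hj ∘ₗ D.Mj ∘ₗ D.Hj

/-- `Q″*aQ″ + Δ_j` — the operator of the `B`-Gaussian of (2.119) (form (2.120)). [cite: Balaban1984PropagatorsII, (2.119)–(2.120) pp.243–244] -/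
def Sb : Bs →ₗ[ℝ] Bs := LinearMap.adjoint D.Qpp ∘ₗ D.a ∘ₗ D.Qpp + D.Δj

/-- `C̃^{(j)}_Λ` — the covariance of the `B`-Gaussian of (2.119) on the axial `B` (p. 246). [cite: Balaban1984PropagatorsII, (2.129) p.246] -/
def Ct : Bs →ₗ[ℝ] Bs := covOp D.Ax D.Sb

/-- The `Ax`-valued factor of `C̃^{(j)}_Λ`. [cite: Balaban1984PropagatorsII, (2.129) p.246] -/
def TB : Bs →ₗ[ℝ] ↥D.Ax := covOpT D.Ax D.Sb

/-- `∂H′_jC^{(j)}_ΛH′_j*∂*` — the first operator of (2.112)/(2.129). [cite: Balaban1984PropagatorsII, (2.112) p.243] -/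
def K1 : A →ₗ[ℝ] A := D.grad ∘ₗ D.hP ∘ₗ D.C ∘ₗ LinearMap.adjoint D.hP ∘ₗ D.dv

/-- `∂ΔH′_jC^{(j)}_ΛH′_j*∂*` — the second operator of (2.112)/(2.129). [cite: Balaban1984PropagatorsII, (2.112) p.243] -/
def K2 : A →ₗ[ℝ] A := D.grad ∘ₗ D.lap ∘ₗ D.hP ∘ₗ D.C ∘ₗ LinearMap.adjoint D.hP ∘ₗ D.dv

/-- The quadratic form of the `A`-integrand of (2.112) = the form (2.120) after `A = A′ + H_jB`:
`⟨Q″Q_jA, aQ″Q_jA⟩ + ⟨A, (Δ − ∂P_j∂*)A⟩`. [cite: Balaban1984PropagatorsII, (2.112) p.243 + (2.120) p.244] -/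
def form2112 (v : A) : ℝ := ⟪D.Qpp (D.Qv v), D.a (D.Qpp (D.Qv v))⟫_ℝ + ⟪v, D.Mj v⟫_ℝ

/-- **The printed lattice identities** the construction uses: `⟨A,ΔA′⟩ = ⟨∂A,∂A′⟩ + ⟨∂*A,∂*A′⟩` on vector fields (2.19);
`∂*` the adjoint of `∂`; `Δ = ∂*∂` on scalars; `∂∂ = 0` (curl of a gradient); `Q′_jH′_j = I` (p. 241: *"where the equality
Q′_jλ = Q′_jH′_jμ = μ was used"*); `ΔH′_jω ⊥ ΔN(Q′_j)`, i.e. `R_jΔH′_jω = 0` (our reading of (2.98)–(2.99) *"(I − P_j)Δλ = 0, or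
Δλ = P_jΔλ"* for `λ = H′_jμ`, the variational definition of `H′_j`); (2.103) `Q_j∂λ = ∂₁Q′_jλ` ([4] (1.20)); (2.104) `Q″∂₁ω = 0` for
admissible `ω`; `Q_j` onto; `a` symmetric positive; (2.96) `∫dω′↾_Λ δ(Q′₁ω′) Π_{y∈Λ′} δ_{Ax(y)}(Q_jA + ∂₁ω′) = 1` read as (our reading):
every `B` is `B′ − ∂₁ω′` for exactly one axial `B′` and one admissible `ω′`. [cite: Balaban1984PropagatorsII, (2.96)–(2.104) pp.240–241] -/
structure IsLattice : Prop where
  lapV_form : ∀ v w : A, ⟪v, D.lapV w⟫_ℝ = ⟪D.curl v, D.curl w⟫_ℝ + ⟪D.dv v, D.dv w⟫_ℝ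
  grad_adj : ∀ (b : B) (x : A), ⟪D.grad b, x⟫_ℝ = ⟪b, D.dv x⟫_ℝ
  dv_grad : ∀ b : B, D.dv (D.grad b) = D.lap b
  curl_grad : ∀ b : B, D.curl (D.grad b) = 0
  Qp_hP : D.Qp ∘ₗ D.hP = LinearMap.id
  hP_orth : ∀ (n : ↥D.Nj) (w : W), ⟪D.lap (n : B), D.lap (D.hP w)⟫_ℝ = 0
  Qv_grad : ∀ b : B, D.Qv (D.grad b) = D.d1 (D.Qp b)
  Qpp_d1 : ∀ ω : ↥D.S₁, D.Qpp (D.d1 (ω : W)) = 0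
  Qv_surj : Function.Surjective D.Qv
  a_symm : ∀ x y : V, ⟪D.a x, y⟫_ℝ = ⟪x, D.a y⟫_ℝ
  a_pos : ∀ x : V, x ≠ 0 → 0 < ⟪x, D.a x⟫_ℝ
  axial : ∀ b : Bs, ∃! ω : ↥D.S₁, b + D.d1 (ω : W) ∈ D.Ax

/-- **The two printed positivity facts.**  `zeroModes`: `Δ_a > 0` in the form proved in Sect. A (pp. 226–228 *"The only
assumption we have used was the positivity of the operator Δ_a"*; the three squares of `⟨A,Δ_aA⟩ = ‖∂A‖² + ‖R∂*A‖² + ⟨QA,aQA⟩`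
vanish only at `A = 0`: `curl A = 0`, `∂*A ⊥ ΔN(Q′)`, `QA = 0` ⇒ `A = 0`); `lapInj`: (2.11) *"the Laplace operator Δ is … invertible
on this subspace"* `N(Q′)`. [cite: Balaban1984PropagatorsII, (2.11) p.225 + (2.19)–(2.22) p.226 + p.228] -/
structure Positive : Prop where
  zeroModes : ∀ v : A, D.curl v = 0 → (∀ m : ↥D.NQ, ⟪D.lap (m : B), D.dv v⟫_ℝ = 0) → D.Qpp (D.Qv v) = 0 → v = 0
  lapInj : ∀ m : ↥D.NQ, D.lap (m : B) = 0 → m = 0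

/-! ## §3  The printed properties of the derived operators -/

variable {D}

/-! ### Unfoldings and symmetry -/

/-- `R g = proj_{ΔN(Q′)} g`. [cite: Balaban1984PropagatorsII, (2.10) p.225] -/
theorem R_apply (g : B) : D.R g = (D.NQ.map D.lap).starProjection g := rfl

/-- `P g = g − Rg`. [cite: Balaban1984PropagatorsII, (2.17) p.226] -/
theorem P_apply (g : B) : D.P g = g - (D.NQ.map D.lap).starProjection g := rfl

/-- `R_j g = proj_{ΔN(Q′_j)} g`. [cite: Balaban1984PropagatorsII, (2.97) p.240] -/
theorem Rj_apply (g : B) : D.Rj g = (D.Nj.map D.lap).starProjection g := rfl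

/-- `P_j g = g − R_jg`. [cite: Balaban1984PropagatorsII, (2.97) p.240] -/
theorem Pj_apply (g : B) : D.Pj g = g - (D.Nj.map D.lap).starProjection g := rfl

/-- `ΔN(Q′) = range(Δ∘ι)` — the hypothesis `hK` of `…B6Eq2112`. [cite: Balaban1984PropagatorsII, (2.10) p.225] -/
theorem range_lap_NQ : LinearMap.range (D.lap ∘ₗ D.NQ.subtype) = D.NQ.map D.lap := by
  rw [LinearMap.range_comp, Submodule.range_subtype]

/-- `ΔN(Q′_j) = range(Δ∘ι_j)` — the hypothesis `hKj` of `…B6Eq2112`. [cite: Balaban1984PropagatorsII, (2.97) p.240] -/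
theorem range_lap_Nj : LinearMap.range (D.lap ∘ₗ D.Nj.subtype) = D.Nj.map D.lap := by
  rw [LinearMap.range_comp, Submodule.range_subtype]

/-- `M_j = Δ − ∂P_j∂*` unfolds. [cite: Balaban1984PropagatorsII, (2.112) p.243] -/
theorem Mj_eq : D.Mj = D.lapV - D.grad ∘ₗ D.Pj ∘ₗ D.dv := rfl

/-- The adjoint pairing of `Q*` (`Q = Q″Q_j`): `⟨Q*w, v⟩ = ⟨w, Q″Q_jv⟩`. [cite: Balaban1984PropagatorsII, (2.19)–(2.20) p.226] -/
theorem Qs_adj (w : V) (v : A) : ⟪LinearMap.adjoint D.Q w, v⟫_ℝ = ⟪w, D.Qpp (D.Qv v)⟫_ℝ := by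
  rw [LinearMap.adjoint_inner_left]; rfl

/-- `Δ` on vector fields is symmetric. [cite: Balaban1984PropagatorsII, (2.19) p.226] -/
theorem lapV_symm (hL : D.IsLattice) (x y : A) : ⟪D.lapV x, y⟫_ℝ = ⟪x, D.lapV y⟫_ℝ := by
  rw [real_inner_comm, hL.lapV_form, hL.lapV_form, real_inner_comm (D.curl x), real_inner_comm (D.dv x)]

/-- `⟨A, ΔA⟩ = ‖curl A‖² + ‖∂*A‖²` (Hodge form of (2.19)). [cite: Balaban1984PropagatorsII, (2.19) p.226] -/
theorem lapV_self (hL : D.IsLattice) (v : A) : ⟪v, D.lapV v⟫_ℝ = ‖D.curl v‖ ^ 2 + ‖D.dv v‖ ^ 2 := by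
  rw [hL.lapV_form, real_inner_self_eq_norm_sq, real_inner_self_eq_norm_sq]

/-- `Δ = ∂*∂` on scalars is symmetric. [cite: Balaban1984PropagatorsII, (2.19) p.226] -/
theorem lap_symm (hL : D.IsLattice) (x y : B) : ⟪D.lap x, y⟫_ℝ = ⟪x, D.lap y⟫_ℝ := by
  rw [← hL.dv_grad, ← hL.dv_grad, ← hL.grad_adj, real_inner_comm, ← hL.grad_adj, real_inner_comm]

/-- `⟨A, ∂λ⟩ = ⟨λ, ∂*A⟩` (`∂*` the adjoint of `∂`). [cite: Balaban1984PropagatorsII, (2.19) p.226] -/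
theorem inner_grad_right (hL : D.IsLattice) (v : A) (u : B) : ⟪v, D.grad u⟫_ℝ = ⟪u, D.dv v⟫_ℝ := by
  rw [← hL.grad_adj, real_inner_comm]

/-- `⟨f, R_jf⟩ = ‖R_jf‖²`. [cite: Balaban1984PropagatorsII, (2.97) p.240] -/
theorem inner_Rj_self (f : B) : ⟪f, D.Rj f⟫_ℝ = ‖D.Rj f‖ ^ 2 :=
  B6Eq297GaugeFixing.inner_starProjection_eq_norm_sq _ f

/-- `⟨f, Rf⟩ = ‖Rf‖²`. [cite: Balaban1984PropagatorsII, (2.10) p.225] -/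
theorem inner_R_self (f : B) : ⟪f, D.R f⟫_ℝ = ‖D.R f‖ ^ 2 :=
  B6Eq297GaugeFixing.inner_starProjection_eq_norm_sq _ f

/-- `⟨A, ∂P_j∂*A⟩ = ‖∂*A‖² − ‖R_j∂*A‖²`. [cite: Balaban1984PropagatorsII, (2.97) p.240] -/
theorem inner_gradPj (hL : D.IsLattice) (v : A) : ⟪v, D.grad (D.Pj (D.dv v))⟫_ℝ = ‖D.dv v‖ ^ 2 - ‖D.Rj (D.dv v)‖ ^ 2 := by
  rw [inner_grad_right hL, Pj, LinearMap.sub_apply, inner_sub_left, LinearMap.id_apply, real_inner_self_eq_norm_sq,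
    real_inner_comm (D.dv v) (D.Rj (D.dv v)), inner_Rj_self]

/-- `⟨A, ∂P∂*A⟩ = ‖∂*A‖² − ‖R∂*A‖²`. [cite: Balaban1984PropagatorsII, (2.19) p.226] -/
theorem inner_gradP (hL : D.IsLattice) (v : A) : ⟪v, D.grad (D.P (D.dv v))⟫_ℝ = ‖D.dv v‖ ^ 2 - ‖D.R (D.dv v)‖ ^ 2 := by
  rw [inner_grad_right hL, P, LinearMap.sub_apply, inner_sub_left, LinearMap.id_apply, real_inner_self_eq_norm_sq,
    real_inner_comm (D.dv v) (D.R (D.dv v)), inner_R_self]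

/-- `M_j` is symmetric. [cite: Balaban1984PropagatorsII, (2.112) p.243] -/
theorem Mj_symm (hL : D.IsLattice) (x y : A) : ⟪D.Mj x, y⟫_ℝ = ⟪x, D.Mj y⟫_ℝ :=
  B6Eq2112Assembly.Mj_symm (D.Nj.map D.lap) D.Pj (fun _ => rfl) D.lapV D.grad D.dv (lapV_symm hL) hL.grad_adj x y

/-- `Δ_a` is symmetric. [cite: Balaban1984PropagatorsII, (2.19) p.226] -/
theorem deltaA_symm (hL : D.IsLattice) (x y : A) : ⟪D.deltaA x, y⟫_ℝ = ⟪x, D.deltaA y⟫_ℝ :=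
  B6Eq2112Assembly.deltaA_symm (D.NQ.map D.lap) D.P (fun _ => rfl) D.lapV D.grad D.dv D.Q (LinearMap.adjoint D.Q) D.a
    (lapV_symm hL) hL.grad_adj (Qs_adj) hL.a_symm x y

/-- **`⟨A, M_jA⟩ = ‖curl A‖² + ‖R_j∂*A‖²`** (the exponent bookkeeping of (2.97)/(2.112)). [cite: Balaban1984PropagatorsII, (2.97) p.240 + (2.112) p.243] -/
theorem form_Mj (hL : D.IsLattice) (v : A) : ⟪v, D.Mj v⟫_ℝ = ‖D.curl v‖ ^ 2 + ‖D.Rj (D.dv v)‖ ^ 2 := by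
  rw [Mj_eq, LinearMap.sub_apply, inner_sub_right, lapV_self hL, LinearMap.comp_apply, LinearMap.comp_apply,
    inner_gradPj hL]
  ring

/-- `⟨A, M_jA⟩ ≥ 0`. [cite: Balaban1984PropagatorsII, (2.112) p.243] -/
theorem form_Mj_nonneg (hL : D.IsLattice) (v : A) : 0 ≤ ⟪v, D.Mj v⟫_ℝ := by
  rw [form_Mj hL]; positivity

/-- **`⟨A, Δ_aA⟩ = ‖curl A‖² + ‖R∂*A‖² + ⟨QA, aQA⟩`** — the three squares of (2.19). [cite: Balaban1984PropagatorsII, (2.19) p.226] -/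
theorem form_deltaA (hL : D.IsLattice) (v : A) :
    ⟪v, D.deltaA v⟫_ℝ = ‖D.curl v‖ ^ 2 + ‖D.R (D.dv v)‖ ^ 2 + ⟪D.Qpp (D.Qv v), D.a (D.Qpp (D.Qv v))⟫_ℝ := by
  have h1 : ⟪v, LinearMap.adjoint D.Q (D.a (D.Q v))⟫_ℝ = ⟪D.Qpp (D.Qv v), D.a (D.Qpp (D.Qv v))⟫_ℝ := by
    rw [real_inner_comm, Qs_adj, real_inner_comm]; rfl
  simp only [deltaA, B6SectA.deltaA, LinearMap.add_apply, LinearMap.sub_apply, LinearMap.comp_apply, inner_add_right,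
    inner_sub_right, h1]
  rw [lapV_self hL, inner_gradP hL]
  ring

/-- `R∂*A = 0 ⟺ ∂*A ⊥ ΔN(Q′)` (the middle square of (2.19)). [cite: Balaban1984PropagatorsII, (2.10) p.225 + (2.19) p.226] -/
theorem R_dv_eq_zero_iff (v : A) : D.R (D.dv v) = 0 ↔ ∀ m : ↥D.NQ, ⟪D.lap (m : B), D.dv v⟫_ℝ = 0 := by
  rw [R_apply, Submodule.starProjection_apply_eq_zero_iff, Submodule.mem_orthogonal]
  constructor
  · intro h m
    exact h _ (Submodule.mem_map_of_mem m.2)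
  · rintro h u ⟨m, hm, rfl⟩
    exact h ⟨m, hm⟩

end TwoScaleData

end Literature.MathematicalPhysics.QuantumFieldTheory.Balaban1983to89.B6SectCOperators

end
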